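import Literature.Probability.Percolation.FourArmGarbanSeparationReduction
import Literature.Probability.Percolation.FourArmGarbanMonotone
import HarnessLib

/-!
# Garban's reduction with square-dependent collar radii, and from large inner scales only

Topic `Literature/Probability/Percolation`; support file for the named fact
`Garban2011_fourArm_multiscale` (`FourArmGarban.lean`; C. Garban, Appendix B of O. Schramm,
S. Smirnov, Ann. Probab. 39 (2011), Lemma B.1). Bond percolation on `ℤ²`, `p = 1/2`. Two
definitions (`GarbanScheme.ofLE`, `squareSchemeVar`: `GarbanScheme`s built from other data), no
named fact.

Two bookkeeping generalisations of `FourArmGarbanSeparationReduction.lean`, needed by the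
docking-by-pigeonhole proof of Garban's (B.4) (`FourArmGarbanExtendability.lean`):

* `squareSchemeVar` / `Garban2011_fourArm_multiscale_of_separation_var` — the same reduction
  as `Garban2011_fourArm_multiscale_of_separation'`, but with the radii `a'_j ≤ b'_j` of the
  collar `S_j = c_j + A_{a'_j, b'_j}` of the circuit bit `C_j` allowed to depend on the square
  `j` (and on both scales), and the separation estimate required only for inner scales `m ≥ m₀`:
  Garban's "`δ` will be chosen later" is, in the pigeonhole rendering of the docking step, a
  choice of one of boundedly many thin collars, square by square. The assembly (`GarbanScheme`,
  `FourArmGarbanAssembly.lean`) was always stated for arbitrary bits `C_j`; only the concrete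
  instantiation fixed common radii.
* `GarbanScheme.ofLE` / `Garban2011_fourArm_multiscale_of_scheme_ge` — **it suffices to build
  the scheme for inner scales `m ≥ m₀`**: a scheme at scales `(m', n)` with `m ≤ m' ≤ M m` is a
  scheme at scales `(m, n)` with constants `K₁/M²`, `K₄ M` (the four-arm probability only
  increases when the inner radius grows, `real_fourArmTwoClusters_mono`), so small `m` are
  served by `m' = max m m₀`.

## References

* O. Schramm, S. Smirnov (appendix by C. Garban), Ann. Probab. 39 (2011), Appendix B, Lemma B.1
  and its proof [SchrammSmirnov2011].
* J. van den Berg, P. Nolin, Progr. Probab. 77 (2020), §4.3 Lemma 8 [VandenbergNolin2020].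

Tree: `GarbanScheme`, `Garban2011_fourArm_multiscale_of_scheme` (`FourArmGarbanAssembly.lean`),
`squareCentres`, `crossingSign`, `card_squareCentres_ge`, `zdArcA_far`, `zdArcB_far`,
`squareCentres_separated`, `isZdAdmissible_square`, `measurable_crossingSign`,
`abs_crossingSign_le`, `setIntegral_reveals_crossingSign_mul_circuitBit`
(`FourArmGarbanSeparationReduction.lean`), `circuitPairs_subset_boxPairs`, `mem_boxPairs_iff`
(`FourArmGarbanConditional.lean`), `integral_indicator_reveals_mul_eq_zero`, `measurableSet_reveals`
(`FourArmGarbanOrthogonality.lean`), `real_reveals_le_twoArmOpenDual` (`FourArmGarbanRevealment.lean`),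
`circuitBit`, `measurable_circuitBit`, `abs_circuitBit_le_one`, `determinedBy_openCircuitInAnnulusAt`,
`determinedBy_dualCircuitInAnnulusAt`, `real_dualCircuitInAnnulusAt_half` (`FourArmGarbanCircuitBits.lean`),
`real_fourArmTwoClusters_mono` (`FourArmGarbanMonotone.lean`).
-/

noncomputable section

namespace Literature.Probability.Percolation

open _root_.MeasureTheory Set LatticeModels LatticeModels.DiscreteDobrushin

/-! ### Schemes from larger inner scales -/

namespace GarbanScheme

variable {K₁ K₂ K₃ K₄ : ℝ} {m m' n M : ℕ}

/-- **A scheme at scales `(m', n)` serves the scales `(m, n)` for `m ≤ m' ≤ M m`**, with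
constants `K₁/M²` and `K₄ M`: the index set, bits and revealment events are unchanged, the count
`K₁ (n/m')² ≥ (K₁/M²)(n/m)²`, the ratio `a/b ≤ K₄ m'/n ≤ K₄ M m/n`, and
`π₄(m, n) ≤ π₄(m', n)` (`1 ≤ m ≤ m' ≤ n`). [folklore] -/
def ofLE (S : GarbanScheme K₁ K₂ K₃ K₄ m' n) (hK₁ : 0 ≤ K₁) (hK₄ : 0 ≤ K₄) (hm : 1 ≤ m)
    (hmm' : m ≤ m') (hm'n : m' ≤ n) (hM1 : 1 ≤ M) (hM : m' ≤ M * m) :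
    GarbanScheme (K₁ / (M : ℝ) ^ 2) K₂ K₃ (K₄ * M) m n where
  J := S.J
  X := S.X
  C := S.C
  V := S.V
  a := S.a
  b := S.b
  card_le := by
    have hm0 : (0 : ℝ) < m := by exact_mod_cast hm
    have hm'0 : (0 : ℝ) < m' := by exact_mod_cast (show 1 ≤ m' by omega)
    have hM0 : (0 : ℝ) < M := by exact_mod_cast hM1
    have hMr : (m' : ℝ) ≤ M * m := by exact_mod_cast hM
    refine le_trans ?_ S.card_le
    have h1 : ((n : ℝ) / m) ^ 2 / (M : ℝ) ^ 2 ≤ ((n : ℝ) / m') ^ 2 := by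
      rw [div_le_iff₀ (by positivity), ← mul_pow, div_mul_eq_mul_div]
      apply pow_le_pow_left₀ (by positivity)
      rw [div_le_div_iff₀ hm0 hm'0]
      calc (n : ℝ) * m' ≤ n * (M * m) := by gcongr
        _ = n * M * m := by ring
    calc K₁ / (M : ℝ) ^ 2 * ((n : ℝ) / m) ^ 2 = K₁ * (((n : ℝ) / m) ^ 2 / (M : ℝ) ^ 2) := by ring
      _ ≤ K₁ * ((n : ℝ) / m') ^ 2 := by gcongr
  memLp_X := S.memLp_X
  integral_sq_X_le := S.integral_sq_X_le
  aestronglyMeasurable_C := S.aestronglyMeasurable_C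
  abs_C_le := S.abs_C_le
  measurableSet_V := S.measurableSet_V
  orthogonal := S.orthogonal
  sep := fun j hj =>
    (real_fourArmTwoClusters_mono half hmm' hm'n le_rfl).trans (S.sep j hj)
  one_le_a := S.one_le_a
  a_le_b := S.a_le_b
  ratio_le := by
    have hn0 : (0 : ℝ) ≤ n := by positivity
    have hMr : (m' : ℝ) ≤ M * m := by exact_mod_cast hM
    calc (S.a : ℝ) / S.b ≤ K₄ * m' / n := S.ratio_le
      _ ≤ K₄ * M * m / n := by
        apply div_le_div_of_nonneg_right _ hn0
        calc K₄ * (m' : ℝ) ≤ K₄ * (M * m) := by gcongr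
          _ = K₄ * M * m := by ring
  reveal := S.reveal

end GarbanScheme

/-- **Garban's lemma from schemes at large inner scales.** If schemes with uniform constants
`K₁ > 0`, `K₂, K₃, K₄ ≥ 0` exist at all scales `m ≥ m₀`, `n ≥ C₀ m` (`m₀, C₀ ≥ 1`), then
`Garban2011_fourArm_multiscale` holds: the scales `m < m₀` are served by the scheme at
`(max m m₀, n)` (`GarbanScheme.ofLE` with `M = m₀`), available as soon as `n ≥ C₀ m₀ · m`.
[cite: SchrammSmirnov2011, Appendix B, Lemma B.1 (proof structure; "changing the radii by bounded factors")] -/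
theorem Garban2011_fourArm_multiscale_of_scheme_ge {K₁ K₂ K₃ K₄ : ℝ} (hK₁ : 0 < K₁)
    (hK₂ : 0 ≤ K₂) (hK₃ : 0 ≤ K₃) (hK₄ : 0 ≤ K₄) {C₀ m₀ : ℕ} (hC₀ : 1 ≤ C₀) (hm₀ : 1 ≤ m₀)
    (hS : ∀ m n : ℕ, m₀ ≤ m → C₀ * m ≤ n → Nonempty (GarbanScheme K₁ K₂ K₃ K₄ m n)) :
    Garban2011_fourArm_multiscale := by
  refine Garban2011_fourArm_multiscale_of_scheme (K₁ := K₁ / (m₀ : ℝ) ^ 2) (K₂ := K₂) (K₃ := K₃)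
    (K₄ := K₄ * m₀) (by positivity) hK₂ hK₃ (by positivity) (C₀ := C₀ * m₀)
    (Nat.one_le_iff_ne_zero.2 (by positivity)) fun m n hm hmn => ?_
  have hm' : m₀ ≤ max m m₀ := le_max_right _ _
  have hM : max m m₀ ≤ m₀ * m := by
    rcases le_total m m₀ with h | h
    · rw [max_eq_right h]; exact Nat.le_mul_of_pos_right _ hm
    · rw [max_eq_left h]; exact Nat.le_mul_of_pos_left _ hm₀
  have hn : C₀ * max m m₀ ≤ n := by
    calc C₀ * max m m₀ ≤ C₀ * (m₀ * m) := Nat.mul_le_mul_left _ hM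
      _ = C₀ * m₀ * m := by ring
      _ ≤ n := hmn
  have hm'n : max m m₀ ≤ n := le_trans (Nat.le_mul_of_pos_left _ hC₀) hn
  obtain ⟨S⟩ := hS (max m m₀) n hm' hn
  exact ⟨S.ofLE hK₁.le hK₄ hm (le_max_left _ _) hm'n hm₀ hM⟩

/-! ### The concrete scheme with square-dependent collar radii -/

/-- `E[X²] ≤ 1` for `|X| ≤ 1`. [folklore] -/
theorem integral_sq_le_one_of_abs_le_one {X : BondConfig (Site 2) → ℝ} (hX : ∀ ω, |X ω| ≤ 1) :
    ∫ ω, X ω ^ 2 ∂(bondPercolation (zdGraph 2) half) ≤ 1 := by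
  calc ∫ ω, X ω ^ 2 ∂(bondPercolation (zdGraph 2) half)
      ≤ ∫ _, (1 : ℝ) ∂(bondPercolation (zdGraph 2) half) :=
        integral_mono_of_nonneg (ae_of_all _ fun ω => sq_nonneg _) (integrable_const 1)
          (ae_of_all _ fun ω => by
            have h := hX ω
            show X ω ^ 2 ≤ 1
            rw [← sq_abs]
            nlinarith [abs_nonneg (X ω)])
    _ = 1 := by simp

/-- **Garban's scheme at the scales `(m, n)` with square-dependent collar radii.** For `m ≥ 1`,
`n ≥ 20 m`, squares `Q_j = c_j + B(ρ)` of half-side `ρ ≤ 4m` centred on the grid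
`squareCentres ρ n` of the square `{0, …, 4n}²`, collar radii `a'_j, b'_j` with `b'_j + 2 ≤ ρ`
(for `a'_j > b'_j` the bit vanishes and `sep` cannot hold unless `π₄ = 0`; no constraint is needed),
bits `C_j = circuitBit c_j a'_j b'_j`, `X = crossingSign n hn`, revealment events
`Reveals hD (boxPairs c_j ρ)`, two-arm radii `(ρ + 2, n)`, and the separation estimate `sep` for
these concrete objects: a `GarbanScheme (1/81) K₂ 1 6 m n`. [cite: SchrammSmirnov2011, Appendix B, proof of Lemma B.1 (the construction)] -/
def squareSchemeVar {m n ρ : ℕ} (a' b' : Site 2 → ℕ) {K₂ : ℝ} (hm : 1 ≤ m) (hn : 20 * m ≤ n)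
    (hρ : ρ ≤ 4 * m) (hb' : ∀ j, b' j + 2 ≤ ρ)
    (sep : ∀ j ∈ squareCentres ρ n,
      (bondPercolation (zdGraph 2) half).real (fourArmTwoClusters m n) ≤
        K₂ * ∫ ω in Reveals (isZdAdmissible_square n (by omega)) (boxPairs j ρ),
          crossingSign n (by omega) ω * circuitBit j (a' j) (b' j) ω ∂(bondPercolation (zdGraph 2) half)) :
    GarbanScheme (1 / 81) K₂ 1 6 m n where
  J := squareCentres ρ n
  X := crossingSign n (by omega)
  C := fun j => circuitBit j (a' j) (b' j)
  V := fun j => Reveals (isZdAdmissible_square n (by omega)) (boxPairs j ρ)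
  a := ρ + 2
  b := n
  card_le := card_squareCentres_ge hm hρ hn
  memLp_X := MemLp.of_bound (measurable_crossingSign n _).aestronglyMeasurable 1
    (ae_of_all _ fun ω => by simpa [Real.norm_eq_abs] using abs_crossingSign_le n _ ω)
  integral_sq_X_le := integral_sq_le_one_of_abs_le_one (abs_crossingSign_le n _)
  aestronglyMeasurable_C := fun j _ => (measurable_circuitBit j (a' j) (b' j)).aestronglyMeasurable
  abs_C_le := fun j _ ω => abs_circuitBit_le_one j (a' j) (b' j) ω
  measurableSet_V := fun j _ => measurableSet_reveals _ _
  orthogonal := fun i hi j hj hij => by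
    have hE := squareCentres_separated ρ n i hi j hj hij
    have hFi := circuitPairs_subset_boxPairs i (show b' i + 1 ≤ ρ by have := hb' i; omega)
    have hFj := circuitPairs_subset_boxPairs j (show b' j + 1 ≤ ρ by have := hb' j; omega)
    exact integral_indicator_reveals_mul_eq_zero _ half hE (hE.mono hFi hFj)
      (fun _ he _ => hFi he) (fun _ he _ => hFj he)
      ((determinedBy_openCircuitInAnnulusAt i (a' i) (b' i)).mono subset_union_left)
      ((determinedBy_dualCircuitInAnnulusAt i (a' i) (b' i)).mono subset_union_right)
      ((determinedBy_openCircuitInAnnulusAt j (a' j) (b' j)).mono subset_union_left)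
      ((determinedBy_dualCircuitInAnnulusAt j (a' j) (b' j)).mono subset_union_right)
      (measurableSet_openCircuitInAnnulusAt i (a' i) (b' i))
      (measurableSet_dualCircuitInAnnulusAt i (a' i) (b' i))
      (measurableSet_openCircuitInAnnulusAt j (a' j) (b' j))
      (measurableSet_dualCircuitInAnnulusAt j (a' j) (b' j))
      (real_dualCircuitInAnnulusAt_half i (a' i) (b' i)).symm
      (real_dualCircuitInAnnulusAt_half j (a' j) (b' j)).symm
  sep := sep
  one_le_a := by omega
  a_le_b := by omega
  ratio_le := by
    have hn0 : (0 : ℝ) < n := by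
      have h1 : (1 : ℝ) ≤ n := by exact_mod_cast (show 1 ≤ n by omega)
      linarith
    have h1 : ((ρ + 2 : ℕ) : ℝ) ≤ 6 * m := by exact_mod_cast (show ρ + 2 ≤ 6 * m by omega)
    exact div_le_div_of_nonneg_right h1 hn0.le
  reveal := fun j hj => by
    rw [one_mul]
    exact real_reveals_le_twoArmOpenDual _ half (k := ρ) le_rfl (by omega)
      (fun _ he x hx => mem_boxPairs_iff.1 he x hx) (zdArcA_far (by omega) hj) (zdArcB_far (by omega) hj)

/-- **Garban's lemma from (B.2)+(B.4) with square-dependent collars, for large inner scales.**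
Fix the size `ρ(m) ≤ 4m` of the mesoscopic squares and, for all scales `(m, n)` and every
square `j`, collar radii `a'(m,n,j)`, `b'(m,n,j) ≤ ρ(m) - 2`. If for some `K₂ ≥ 0`, `C₀ ≥ 20`,
`m₀ ≥ 1`, at all scales `m ≥ m₀`, `n ≥ C₀ m` and for every mesoscopic square `Q_j` of the square
`{0, …, 4n}²`,

  `P_{1/2}(fourArmTwoClusters m n) ≤ K₂ · E[X · C_j]`  (`C_j = circuitBit c_j a'(m,n,j) b'(m,n,j)`),

then the named fact `Garban2011_fourArm_multiscale` holds ((B.7) `E[X C_j Y_j] = E[X C_j]` is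
the tree's `setIntegral_reveals_crossingSign_mul_circuitBit`). [cite: SchrammSmirnov2011, Appendix B, Lemma B.1, (B.2) and (B.4)] -/
theorem Garban2011_fourArm_multiscale_of_separation_var (ρ : ℕ → ℕ) (a' b' : ℕ → ℕ → Site 2 → ℕ)
    (hρ : ∀ m, 1 ≤ m → ρ m ≤ 4 * m) (hb' : ∀ m n j, 1 ≤ m → b' m n j + 2 ≤ ρ m) {K₂ : ℝ} (hK₂ : 0 ≤ K₂) {C₀ : ℕ} (hC₀ : 20 ≤ C₀)
    {m₀ : ℕ} (hm₀ : 1 ≤ m₀)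
    (hsep : ∀ (m n : ℕ) (hm : m₀ ≤ m) (hmn : C₀ * m ≤ n) (hn : 1 ≤ n), ∀ j ∈ squareCentres (ρ m) n,
      (bondPercolation (zdGraph 2) half).real (fourArmTwoClusters m n) ≤
        K₂ * ∫ ω, crossingSign n hn ω * circuitBit j (a' m n j) (b' m n j) ω
          ∂(bondPercolation (zdGraph 2) half)) :
    Garban2011_fourArm_multiscale := by
  refine Garban2011_fourArm_multiscale_of_scheme_ge (K₁ := 1 / 81) (K₂ := K₂) (K₃ := 1) (K₄ := 6)
    (by norm_num) hK₂ zero_le_one (by norm_num) (C₀ := C₀) (m₀ := m₀) (by omega) hm₀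
    fun m n hm hmn => ?_
  have hm1 : 1 ≤ m := le_trans hm₀ hm
  have hn : 20 * m ≤ n := le_trans (Nat.mul_le_mul_right _ hC₀) hmn
  have hn1 : 1 ≤ n := by omega
  refine ⟨squareSchemeVar (a' m n) (b' m n) hm1 hn (hρ m hm1) (fun j => hb' m n j hm1)
    fun j hj => ?_⟩
  rw [setIntegral_reveals_crossingSign_mul_circuitBit hn1 (hb' m n j hm1) j]
  exact hsep m n hm hmn hn1 j hj

end Literature.Probability.Percolation
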